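import Summits.BirchSwinnertonDyer.Rank1Residual.GaloisImage.GreenbergConditionOfStrictCondition
import Summits.BirchSwinnertonDyer.Rank1Residual.X2.NonPrimitiveLambdaInvariantOfDatum
import Summits.BirchSwinnertonDyer.BirchSwinnertonDyer.Theorems.PublishedInputsGreenbergKummerImageHolds
import HarnessLib

set_option linter.dupNamespace false -- `…BirchSwinnertonDyer.BirchSwinnertonDyer…` is the cell's nested layout (D-0017)
set_option autoImplicit false

/-!
# Greenberg–Vatsal 2000 §2 p. 26 (`L_𝔭 ⊆ im κ_𝔭` over `ℚ_∞` at a good ORDINARY `p`, registry A111) HOLDS: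
# the named fact `GreenbergVatsal2000.imKummer_ge_greenbergCondition_at_p` is a theorem of the tree —
# a hypothesis-free `_holds` term, and the binder-free forms of its two kernel consumers

Cell `bsd-2adic` (run/shared/lean/pub/bsd-2adic/), seat `bsd-2adic-t42` (BRIEF-T42), GEN 25. THEOREMS ONLY (no
definition, no named fact, no instance, no `sorry`); nothing is restated; `--supports stmt-BirchSwinnertonDyer-19923`.

R. Greenberg, V. Vatsal, *On the Iwasawa invariants of elliptic curves*, Invent. Math. 142 (2000), §2 p. 26
(← R. Greenberg, *Iwasawa theory for elliptic curves*, LNM 1716 (1999), §2 Props. 2.2, 2.4, pp. 73–75): at the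
prime `𝔭` of the cyclotomic `ℤ_p`-extension `ℚ_∞` above a good ordinary `p` of `E/ℚ`, Greenberg's INERTIA-form
local condition `L_𝔭 = ker(H¹((ℚ_∞)_𝔭, E[p^∞]) → H¹(I_𝔭, E[p^∞]/C_p))` is contained in the image of the local
Kummer map. The tree typed the statement as the named fact
`GreenbergVatsal2000.imKummer_ge_greenbergCondition_at_p` (`Literature/…/GreenbergVatsal2000/LocalConditionAtP.lean`,
registry A111) — the binder `hA111` of the cell's multiplicative congruence transport
(`MultTransportAtTwo.multCongruenceTransportAtTwo_of_print49{,_nonsplit}` / `_of_printFacts` and the primed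
non-split final door `bsdp_two_nonsplit_of_gvTransportPinch_of_print49_of_descent'`, files XLII/XLIII) and the
binder `hGV` of the good-ordinary congruence / aligned-transport doors (X5 `TwoAdicInstancesGV…`,
`AlignedTransportAtTwo…RealKummerLines…`), 461 tree files in all. Two tree theorems compose to it and had not been
composed:

* cell b2b-bsdres, `Rank1Residual/GaloisImage/GreenbergConditionOfStrictCondition.lean`:
  `imKummer_ge_greenbergCondition_at_p_of_strict : A239 → A111` — Greenberg 1999 Prop. 2.4 in its STRICT
  (decomposition-group) form (`Greenberg1999.imKummer_ge_strictCondition_goodOrdinary`, registry A239) implies the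
  inertia form, because at the totally ramified prime of `ℚ_∞` above `p` inertia fills the decomposition group up to
  a Frobenius and `Frob − 1` is onto on the divisible unramified quotient `Ẽ[p^∞]`
  (`X2/GreenbergVatsalStrictAtP.greenbergKer_le_strictKer`);
* seat bsd-inputs-k4-p1, `Theorems/PublishedInputsGreenbergKummerImageHolds.lean`:
  `imKummer_ge_strictCondition_goodOrdinary_holds : A239` — PROVED (2026-08-28) from the Coates–Greenberg record
  `H¹(K, Ê) = 0` over the deeply ramified `(ℚ_∞)_𝔭`, itself a kernel theorem (Tate's almost étale lemma, cell
  bsd-wall).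

This file records the composition and the binder-free forms of the two X2 consumers:

* `imKummer_ge_greenbergCondition_at_p_holds : GreenbergVatsal2000.imKummer_ge_greenbergCondition_at_p` — every
  binder `(hA111 / hGV : GreenbergVatsal2000.imKummer_ge_greenbergCondition_at_p)` is discharged by this term;
* `greenbergKer_reductionDatum_le_localKerOver` — the same at the tree's chosen datum, as an inequality;
* `localKerOver_eq_greenbergKer_and_strictKer` — X2's «all three local conditions at `p` coincide over `ℚ_∞`»
  (Kummer = inertia form = strict form for the good-ordinary reduction datum) with NO fact binder;
* `lambda_nonPrimitive_eq_add_sum_delta_of_datumRecord` — X2's derivation of Greenberg–Vatsal (6)–(7) at an odd good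
  ordinary `p` (`GreenbergVatsal2000.lambda_nonPrimitive_eq_add_sum_delta`, registry A115) now rests on the datum
  record `GreenbergVatsal2000.datumSelmer_nonPrimitive_invariants` (T-GV23L) ALONE.

HONEST FRAMING: compositions of tree theorems (the mathematics is Tate's almost étale lemma — cell bsd-wall —,
b2b-bsdres' Kummer derivation and the X2 lineage's inertia-versus-strict comparison); the printed statement AS TYPED is
now unconditional; no item is closed; no display is re-keyed by this file (D-0152); no crux and no summit statement is
proved; BSD is not proved by any of this.

References: [GreenbergVatsal2000] §1 (6)–(7) pp. 7–8, §2 pp. 16, 20–22, 26; [GreenbergLNM1716] §2 Props. 2.2, 2.4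
(pp. 73–75), p. 83; [CoatesGreenberg1996] Cor. 3.2, Prop. 4.3; [Tate1967] §3.2 Prop. 9.
-/

noncomputable section

open scoped Classical NNReal

namespace Summit.BirchSwinnertonDyer.BirchSwinnertonDyer.Theorems.InputsGreenbergVatsalLocalConditionAtP

open NumberField IsDedekindDomain Field Literature.NumberTheory.GaloisRepresentations
  Literature.NumberTheory.EllipticCurves Literature.NumberTheory.EllipticCurves.GreenbergSelmer
  Literature.NumberTheory.EllipticCurves.Greenberg1999
  Literature.NumberTheory.EllipticCurves.GreenbergVatsal2000
  Summit.BirchSwinnertonDyer.Rank1Residual.X2.GreenbergVatsalReductionDatum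
  Summit.BirchSwinnertonDyer.Rank1Residual.X2
  Summit.BirchSwinnertonDyer.Rank1Residual.GaloisImage.GreenbergConditionOfStrictCondition
  Summit.BirchSwinnertonDyer.BirchSwinnertonDyer.Theorems.InputsGreenbergKummerImage
open WeierstrassCurve (minimalDiscriminantInt)

/-- **Greenberg–Vatsal 2000 §2 p. 26 / Greenberg LNM 1716 Prop. 2.4, inertia form over `ℚ_∞`, HOLDS** (registry A111,
`GreenbergVatsal2000.imKummer_ge_greenbergCondition_at_p`: for `E/ℚ` globally minimal, `p` good ordinary, the
cyclotomic `κ`, the place `v ∋ p`, any spectral valuation / reduction map / Greenberg datum of the printed shape, every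
class of `H¹(ker κ, E[p^∞])` satisfying Greenberg's inertia condition above `v` is Kummer there) — the `hA111` / `hGV`
binder of the 2-adic congruence-transport and aligned-transport doors, discharged: b2b-bsdres' `A239 → A111` fed the
proved A239. [cite: GreenbergVatsal2000, §2 p. 16 (L_𝔭) and p. 26] [cite: GreenbergLNM1716, §2 Props. 2.2, 2.4 (pp. 73–75)]
[cite: CoatesGreenberg1996, Cor. 3.2 and Prop. 4.3] -/
theorem imKummer_ge_greenbergCondition_at_p_holds : imKummer_ge_greenbergCondition_at_p :=
  imKummer_ge_greenbergCondition_at_p_of_strict imKummer_ge_strictCondition_goodOrdinary_holds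

/-- **`L_𝔭 ⊆ im κ_𝔭` at the tree's chosen datum, binder-free**: for the good-ordinary reduction datum
`reductionDatum W p hpv hΔ` (`C_p = ker(E[p^∞] → Ẽ)`) and `H = ker κ`, `greenbergKer ≤ localKerOver`.
[cite: GreenbergVatsal2000, §2 p. 26] [cite: GreenbergLNM1716, §2 Prop. 2.4 (pp. 74–75)] -/
theorem greenbergKer_reductionDatum_le_localKerOver (W : WeierstrassCurve ℚ) [W.IsGloballyMinimal]
    [W.IsElliptic] (p : ℕ) [Fact p.Prime] (hΔ : ¬ (p : ℤ) ∣ minimalDiscriminantInt W)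
    (hord : ¬ (p : ℤ) ∣ W.frobeniusTrace p) (κ : ZpExtension ℚ p) (hκ : κ.IsCyclotomic)
    {v : HeightOneSpectrum (𝓞 ℚ)} (hpv : ((p : ℕ) : 𝓞 ℚ) ∈ v.asIdeal) :
    (reductionDatum W p hpv hΔ).greenbergKer κ.kerSubgroup ≤
      W.localKerOver p κ.kerSubgroup (v.adicCompletion ℚ) :=
  greenbergKer_reductionDatum_le_localKerOver_of_strict imKummer_ge_strictCondition_goodOrdinary_holds W p hΔ
    hord κ hκ hpv

/-- **All three local conditions at `p` coincide over `ℚ_∞^{cyc}`, UNCONDITIONALLY** (X2's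
`GreenbergVatsalStrictAtP.localKerOver_eq_greenbergKer_and_strictKer` with its `hGV` binder discharged): for `E/ℚ`
globally minimal, `p` good ordinary, `κ` cyclotomic and the place `v ∋ p`, Kummer = Greenberg's inertia form =
the strict form for the reduction datum `C_p = ker(E[p^∞] → Ẽ)`. [cite: GreenbergLNM1716, §2 Props. 2.2, 2.4 (pp. 73–75)]
[cite: GreenbergVatsal2000, §2 pp. 16, 26] -/
theorem localKerOver_eq_greenbergKer_and_strictKer (W : WeierstrassCurve ℚ) [W.IsGloballyMinimal]
    [W.IsElliptic] (p : ℕ) [Fact p.Prime] (κ : ZpExtension ℚ p) (hκ : κ.IsCyclotomic)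
    {v : HeightOneSpectrum (𝓞 ℚ)} (hpv : ((p : ℕ) : 𝓞 ℚ) ∈ v.asIdeal)
    (hΔ : ¬ (p : ℤ) ∣ minimalDiscriminantInt W) (hord : ¬ (p : ℤ) ∣ W.frobeniusTrace p) :
    W.localKerOver p κ.kerSubgroup (v.adicCompletion ℚ) =
        (reductionDatum W p hpv hΔ).greenbergKer κ.kerSubgroup ∧
      W.localKerOver p κ.kerSubgroup (v.adicCompletion ℚ) =
        (reductionDatum W p hpv hΔ).strictKer κ.kerSubgroup :=
  GreenbergVatsalStrictAtP.localKerOver_eq_greenbergKer_and_strictKer W p κ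
    imKummer_ge_greenbergCondition_at_p_holds hκ hpv hΔ hord

/-- **Greenberg–Vatsal (6)–(7) at an odd good ordinary prime modulo the datum record ALONE** (registry A115,
`GreenbergVatsal2000.lambda_nonPrimitive_eq_add_sum_delta` ⇐ T-GV23L
`GreenbergVatsal2000.datumSelmer_nonPrimitive_invariants`): X2's
`NonPrimitiveLambdaInvariantOfDatum.lambda_nonPrimitive_eq_add_sum_delta_of_datum` with its second input `hGV` (A111)
discharged by `imKummer_ge_greenbergCondition_at_p_holds`. GV p. 26: "`Sel_E(ℚ_∞)_p = S_A(ℚ_∞)`. The nonprimitive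
Selmer groups … also coincide … Corollary (2.3) then implies the important relationships (6) and (7)".
[cite: GreenbergVatsal2000, §1 (6)–(7) pp. 7–8; §2 Cor. (2.3), Prop. (2.4) (pp. 20–22); p. 26]
[cite: GreenbergLNM1716, §2 Props. 2.2, 2.4 (pp. 73–75)] -/
theorem lambda_nonPrimitive_eq_add_sum_delta_of_datumRecord (h23 : datumSelmer_nonPrimitive_invariants) :
    lambda_nonPrimitive_eq_add_sum_delta :=
  NonPrimitiveLambdaInvariantOfDatum.lambda_nonPrimitive_eq_add_sum_delta_of_datum h23
    imKummer_ge_greenbergCondition_at_p_holds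

end Summit.BirchSwinnertonDyer.BirchSwinnertonDyer.Theorems.InputsGreenbergVatsalLocalConditionAtP

end
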